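/-
Copyright (c) 2026 the pub-hodgecm-mathlib formalisation cell (harness21).  Prover seat hodgecm-mathlib-K2E1-p04 (g2), Track B ∕ K2-LIT
(build stream 29), h413 = `stmt-HodgeConjecture-24833`, line `K2_E1_TraceFormulaBeta`; BY-NAME DEAL of the dealer K2E1-plan (g0)
2026-09-03T22:23:49Z (`K2E1SupercuspidalJacquetVanishingU2`), satellite 2 of 2: item (i) the exhaustion of `N_v`, and item (iii) the unconditional corollary.
-/
import Summits.HodgeConjecture.HodgeConjecture.Theorems.K2E1SupercuspidalJacquetVanishingU2   -- ★ item (ii): `cm_forall_mem_span_sub_of_isSupercuspidal_two` (hJ), torus family (satellite 1)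
import Summits.HodgeConjecture.HodgeConjecture.Theorems.K2E1SupercuspidalCoefficientNCuspidal  -- ★ p855253: `UnitaryGroup.integral_idempotent_translate_cmBorelN_eq_zero`
import Literature.NumberTheory.Automorphic.ParabolicInductionSupercuspidalProofs                -- ★ `exists_pow_mul_le` (archimedean value group)
import Literature.NumberTheory.Automorphic.ReductionTheoryGLnConjugation                       -- ★ `isClosed_upperUnitriangular`
import HarnessLib

/-!
# K2·E1 — `K2E1UnipotentExhaustionU2`: the unipotent radical `N_v` of the Borel of `U(Φ₂)(L⁺_v)` is an increasing union of compact open subgroups (item (i)),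
# and the UNCONDITIONAL `N_v`-cuspidality of supercuspidal matrix coefficients ∕ of the normalised idempotent at a non-split place (item (iii))

Track B ∕ K2-LIT, crux h413 = `stmt-HodgeConjecture-24833`, route of record `HCCMUnconditional`; cell `hodgecm-mathlib`, squad K2; prover seat
`hodgecm-mathlib-K2E1-p04` (g2), BY-NAME DEAL of the dealer K2E1-plan (g0) 2026-09-03T22:23:49Z, items (i) and (iii); lane `--supports stmt-HodgeConjecture-24833
--as helper` (count-neutral).  THEOREMS ONLY (no `def`, no `instance`, no notation, no named-fact hypothesis, no `sorry`).

THE MATHEMATICS [Casselman1995 Prop. 1.4.4; Rogawski1990 §1.10 p. 9].  In `U = U(σ, Φ₂)(K)` the unipotent radical of the upper-triangular Borel is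
`N = {u(b) = [[1, b], [0, 1]] : b + σ b = 0}`; conjugation by the torus element `a_j = d(ϖ^j, ϖ^{-j})` (★ satellite `exists_torusU_family_two`) multiplies
`b` by `ϖ^{2j}`, so `N_j = {n ∈ N : a_j n a_j⁻¹ ∈ K_{|ϖ|}}` (`K_γ` the principal congruence subgroup of `GL₂`) is a compact open subgroup of `N`, `N_j ⊆ N_{j+1}`
(contraction), and `⋃_j N_j = N` (archimedean value group) — the Φ₂ twin of ★ `UnitaryGroup.exists_compactOpen_subgroups_exhausting_unipotentU_three` (proof
adapted verbatim, the `(i, k)` entry being multiplied by `ϖ^{2j(k − i)}`).  At a NON-SPLIT place `v` of `L⁺` the one-place model ★ `localNonsplitEquiv :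
U(Φ₂)(L⁺_v) ≃ₜ* U(σ_w, Φ₂)(L_w)` matches the radicals in BOTH directions, so the exhaustion transports to `N_v = (cmBorelTriple L 2 v).N`.  With the Jacquet
vanishing of satellite ★ `K2E1SupercuspidalJacquetVanishingU2` this DISCHARGES the two hypotheses `hJ`, `Nj` of ★ p855253
`K2E1SupercuspidalCoefficientNCuspidal.…integral_idempotent_translate_cmBorelN_eq_zero` for `N = 2`.

* §1 model `U(σ, Φ₂)(K)`: `valBound_torusTwoConj_sub_one_of_unitriangular`, **`exists_compactOpen_subgroups_exhausting_unipotentU_two`**; §2 CM, non-split `v`: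
  `localNonsplitEquiv_mem_unipotentU_of_mem_cmBorelTriple_N_two`, **`cm_exists_compactOpen_subgroups_exhausting_cmBorelN_two`** (`N_v = (cmBorelTriple L 2 v).N`).
* §3 (iii) **`UnitaryGroup.integral_idempotent_translate_cmBorelN_two_eq_zero`** — `L` CM, `v` non-split, `G_v = U(Φ₂)(L⁺_v)` with COMPACT CENTRE (`hZ`, the frame fact
  of the non-split place, carried as in ★ `U3SupercuspidalCoefficientSelberg`), `μ` right-invariant finite on compacta on `N_v`, `ρ₀` smooth SUPERCUSPIDAL with a
  `G_v`-invariant Hermitian `B`, `e g = c · B (ρ₀ g u) u` (K2E1-p06 (g2)'s ★ p855188 idempotent): `∀ x y, ∫_{N_v} e(x n y) dμ(n) = 0` UNCONDITIONALLY in `hJ`∕`Nj`;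
  and the coefficient form `…integral_sesqForm_translate_apply_cmBorelN_two_eq_zero`.
HONEST LABEL: HC_CM is proved only modulo the 7 printed citations (2 remaining named inputs: hLiu418 = `stmt-HodgeConjecture-24832`, h413 =
`stmt-HodgeConjecture-24833`) until rung 0 closes; this file moves no counter.  References: [Casselman1995] Prop. 1.4.4, Thm. 5.3.1; [Rogawski1990] §1.10 p. 9,
§12.2 p. 173, §13.8 p. 218 (i)–(iii); [HarishChandra1970] Part I §3 p. 9; [PlatonovRapinchuk1994] §5.1.
-/

set_option autoImplicit false
-- the mandated namespace repeats the single-problem summit's segment (`HodgeConjecture.HodgeConjecture`)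
set_option linter.dupNamespace false

noncomputable section

open MeasureTheory Set Filter Topology
open scoped MatrixGroups Pointwise Topology
open ValuativeRel Matrix
open Literature.NumberTheory.Automorphic Literature.NumberTheory.Automorphic.UnitaryGroup
open Summit.HodgeConjecture.HodgeConjecture.Cruxes.H413.K2E1UnitaryTwoTorusContraction
open Summit.HodgeConjecture.HodgeConjecture.Cruxes.H413.K2E1SupercuspidalJacquetVanishingU2

namespace Summit.HodgeConjecture.HodgeConjecture.Cruxes.H413.K2E1UnipotentExhaustionU2

/-! ## §1 The exhaustion of `N ≤ U(σ, Φ₂)(K)` by compact open subgroups -/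

section Model

variable {K : Type*} [Field K] [ValuativeRel K] [TopologicalSpace K] [IsNonarchimedeanLocalField K]
  (σ : K →+* K) {J : Matrix (Fin 2) (Fin 2) K}

omit [TopologicalSpace K] [IsNonarchimedeanLocalField K] in
/-- **Conjugation by `a_j = d(ϖ^j, ϖ^{-j})` CONTRACTS the upper unitriangular matrices of `GL₂`**: if `g` is upper unitriangular with `|(g − 1)_{ik}| ≤ δ`, then
`|(a_j g a_j⁻¹ − 1)_{ik}| ≤ |ϖ|^j δ` (the `(0, 1)` entry is multiplied by `ϖ^{2j}`, `|ϖ| ≤ 1`) — Φ₂ twin of ★ `UnitaryGroup.valBound_torusConj_sub_one_of_unitriangular`.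
[cite: Casselman1995, Prop. 1.4.4] [cite: Rogawski1990, §1.10 p. 9] -/
theorem valBound_torusTwoConj_sub_one_of_unitriangular {ϖ : K} (hϖ0 : ϖ ≠ 0) (hϖ1 : valuation K ϖ ≤ 1)
    {g : GL (Fin 2) K} (hut : (g : Matrix (Fin 2) (Fin 2) K).BlockTriangular id) (hdiag : ∀ i, (g : Matrix (Fin 2) (Fin 2) K) i i = 1)
    {δ : ValueGroupWithZero K} (hδ : ValBound δ ((g : Matrix (Fin 2) (Fin 2) K) - 1)) (j : ℕ) :
    ValBound (valuation K ϖ ^ j * δ)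
      (((zpowDiagGL hϖ0 (fun i : Fin 2 => (j : ℤ) * (1 - 2 * (i.val : ℤ))) * g *
          (zpowDiagGL hϖ0 (fun i : Fin 2 => (j : ℤ) * (1 - 2 * (i.val : ℤ))))⁻¹ : GL (Fin 2) K) : Matrix (Fin 2) (Fin 2) K) - 1) := by
  intro i k
  rw [coe_zpowDiagGL_mul_mul_inv_sub_one_apply, map_mul, map_zpow₀]
  rcases lt_trichotomy i k with hik | rfl | hki
  · -- above the diagonal: the exponent is `2 j (k - i)` with `k - i ≥ 1`
    have hik' : i.val < k.val := hik
    have hexp : (j : ℤ) * (1 - 2 * (i.val : ℤ)) - (j : ℤ) * (1 - 2 * (k.val : ℤ)) = ((2 * j * (k.val - i.val) : ℕ) : ℤ) := by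
      rw [Nat.cast_mul, Nat.cast_mul, Nat.cast_sub hik'.le]
      push_cast
      ring
    rw [hexp, zpow_natCast]
    have hle : valuation K ϖ ^ (2 * j * (k.val - i.val)) ≤ valuation K ϖ ^ j := by
      have h1 : j ≤ 2 * j * (k.val - i.val) := by
        have h2 : 1 ≤ k.val - i.val := by omega
        nlinarith
      exact pow_le_pow_right_of_le_one' hϖ1 h1
    exact mul_le_mul' hle (hδ i k)
  · -- on the diagonal `(g - 1)_{ii} = 0`
    have h0 : ((g : Matrix (Fin 2) (Fin 2) K) - 1) i i = 0 := by
      rw [Matrix.sub_apply, hdiag i, Matrix.one_apply_eq, sub_self]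
    rw [h0, map_zero, mul_zero]
    exact zero_le
  · -- below the diagonal `g_{ik} = 0 = 1_{ik}`
    have h0 : ((g : Matrix (Fin 2) (Fin 2) K) - 1) i k = 0 := by
      rw [Matrix.sub_apply, hut hki, Matrix.one_apply_ne (ne_of_gt hki), sub_zero]
    rw [h0, map_zero, mul_zero]
    exact zero_le

/-- **THE UNIPOTENT RADICAL `N ≤ U(σ, Φ₂)(K)` IS AN INCREASING UNION OF COMPACT OPEN SUBGROUPS.**  For `σ` continuous and a `σ`-fixed `ϖ ≠ 0` with `|ϖ| < 1`:
`N_j = {n ∈ N ∣ a_j n a_j⁻¹ ∈ K_{|ϖ|}}`, `a_j = d(ϖ^j, ϖ^{-j})` (★ satellite `exists_torusU_family_two`), `K_γ` the principal congruence subgroup of `GL₂`, is a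
compact open subgroup of `N`; `N_j ⊆ N_{j+1}` because conjugation by `a_1` contracts; and every `n ∈ N` lies in some `N_j` (archimedean value group).  Proof adapted
verbatim from ★ `UnitaryGroup.exists_compactOpen_subgroups_exhausting_unipotentU_three`. [cite: Casselman1995, Prop. 1.4.4] [cite: Rogawski1990, §1.10 p. 9] -/
theorem exists_compactOpen_subgroups_exhausting_unipotentU_two (hJ : J = (StdForm.antidiagonal 2).over K) (hσc : Continuous σ)
    {ϖ : K} (hϖ0 : ϖ ≠ 0) (hϖ1 : valuation K ϖ < 1) (hσϖ : σ ϖ = ϖ) :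
    ∃ Nj : ℕ → Subgroup ↥(unipotentU σ J), Monotone Nj ∧ (∀ j, IsCompact (Nj j : Set ↥(unipotentU σ J))) ∧
      (∀ j, IsOpen (Nj j : Set ↥(unipotentU σ J))) ∧ ∀ n : ↥(unipotentU σ J), ∃ j, n ∈ Nj j := by
  haveI : T2Space K := (Literature.NumberTheory.GaloisRepresentations.IsNonarchimedeanLocalField.isLocalField K).toT2Space
  obtain ⟨a, ha, -, -, haM, -⟩ := exists_torusU_family_two σ hJ hϖ0 hσϖ
  -- the torus normalises `N`
  have hnorm : ∀ {t : ↥(unitaryGroupOfForm σ J)}, t ∈ torusU σ J → ∀ u : ↥(unitaryGroupOfForm σ J), u ∈ unipotentU σ J →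
      t * u * t⁻¹ ∈ unipotentU σ J := fun ht u hu => by
    have h := (borelU_le_normalizer σ J) (torusU_le_borelU σ J ht)
    rw [Subgroup.mem_normalizer_iff] at h
    exact (h u).1 hu
  have haT : ∀ j, a j ∈ torusU σ J := fun j => haM j
  have hγ0 : valuation K ϖ ≠ 0 := (Valuation.ne_zero_iff _).2 hϖ0
  -- the principal congruence subgroup `K_γ ∩ U`, `γ = |ϖ|`
  set Kγ : Subgroup ↥(unitaryGroupOfForm σ J) := (congruenceGL 2 (valuation K ϖ)).comap (unitaryGroupOfForm σ J).subtype with hKγ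
  obtain ⟨hKc, hKo⟩ := isCompact_isOpen_unitaryCongruence σ (J := J) hσc hγ0
  -- the conjugation maps `c_j : N → U`, `n ↦ a_j n a_j⁻¹`
  set c : ℕ → (↥(unipotentU σ J) →* ↥(unitaryGroupOfForm σ J)) := fun j =>
    (MulAut.conj (a j)).toMonoidHom.comp (unipotentU σ J).subtype with hc
  have hc_apply : ∀ j (n : ↥(unipotentU σ J)), c j n = a j * n * (a j)⁻¹ := fun j n => rfl
  have hc_cont : ∀ j, Continuous (c j) := fun j =>
    ((continuous_const.mul continuous_subtype_val).mul continuous_const)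
  -- the key computation: `a_j n a_j⁻¹ ∈ K_γ` as soon as `|ϖ|^j · sup |(n - 1)_{ik}| ≤ γ`
  have hkey : ∀ (j : ℕ) (n : ↥(unitaryGroupOfForm σ J)), n ∈ unipotentU σ J → ∀ δ : ValueGroupWithZero K,
      ValBound δ (((n : GL (Fin 2) K) : Matrix (Fin 2) (Fin 2) K) - 1) → valuation K ϖ ^ j * δ ≤ valuation K ϖ →
      ((a j * n * (a j)⁻¹ : ↥(unitaryGroupOfForm σ J)) : GL (Fin 2) K) ∈ congruenceGL 2 (valuation K ϖ) := by
    intro j n hn δ hδ hle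
    obtain ⟨hut, hdiag⟩ := (mem_unipotentU_iff _).1 hn
    rw [Subgroup.coe_mul, Subgroup.coe_mul, Subgroup.coe_inv, ha]
    exact mem_congruenceGL_of_valBound_sub_one hϖ1
      ((valBound_torusTwoConj_sub_one_of_unitriangular hϖ0 hϖ1.le hut hdiag hδ j).mono hle)
  refine ⟨fun j => Kγ.comap (c j), ?_, ?_, ?_, ?_⟩
  · -- monotone: `a_{j+1} n a_{j+1}⁻¹ = a_1 (a_j n a_j⁻¹) a_1⁻¹`, and `a_j n a_j⁻¹ ∈ N ∩ K_γ`
    refine monotone_nat_of_le_succ fun j n hn => ?_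
    rw [Subgroup.mem_comap] at hn ⊢
    rw [Subgroup.mem_comap] at hn ⊢
    have hcomm : a (j + 1) = a 1 * a j := by
      apply Subtype.ext
      rw [Subgroup.coe_mul, ha, ha, ha, ← zpowDiagGL_add]
      congr 1
      funext i
      simp only [Pi.add_apply]
      push_cast
      ring
    have hconj : (c (j + 1) n : ↥(unitaryGroupOfForm σ J)) = a 1 * (c j n) * (a 1)⁻¹ := by
      rw [hc_apply, hc_apply, hcomm, _root_.mul_inv_rev]
      group
    have hmN : (c j n : ↥(unitaryGroupOfForm σ J)) ∈ unipotentU σ J := by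
      rw [hc_apply]
      exact hnorm (haT j) n n.2
    have hmK : ((c j n : ↥(unitaryGroupOfForm σ J)) : GL (Fin 2) K) ∈ congruenceGL 2 (valuation K ϖ) := hn
    show ((c (j + 1) n : ↥(unitaryGroupOfForm σ J)) : GL (Fin 2) K) ∈ congruenceGL 2 (valuation K ϖ)
    rw [hconj]
    refine hkey 1 (c j n) hmN (valuation K ϖ) (mem_congruenceGL_iff.1 hmK).2.1 ?_
    rw [pow_one]
    exact mul_le_of_le_one_left' hϖ1.le
  · intro j -- compact: `N_j` is the image of the compact `N ∩ K_γ` under the homeomorphism `m ↦ a_j⁻¹ m a_j` of `N`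
    have hNcl : IsClosed (unipotentU σ J : Set ↥(unitaryGroupOfForm σ J)) :=
      (isClosed_upperUnitriangular (n := 2) (R := K)).preimage continuous_subtype_val
    have hemb : Topology.IsClosedEmbedding (Subtype.val : ↥(unipotentU σ J) → ↥(unitaryGroupOfForm σ J)) :=
      hNcl.isClosedEmbedding_subtypeVal
    have hC : IsCompact ((Subtype.val : ↥(unipotentU σ J) → ↥(unitaryGroupOfForm σ J)) ⁻¹' (Kγ : Set ↥(unitaryGroupOfForm σ J))) :=
      hemb.isCompact_preimage hKc
    have hinvN : ∀ m : ↥(unipotentU σ J), (a j)⁻¹ * (m : ↥(unitaryGroupOfForm σ J)) * a j ∈ unipotentU σ J := fun m => by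
      simpa only [inv_inv] using hnorm (inv_mem (haT j)) m m.2
    set d : ↥(unipotentU σ J) → ↥(unipotentU σ J) := fun m => ⟨(a j)⁻¹ * (m : ↥(unitaryGroupOfForm σ J)) * a j, hinvN m⟩ with hd
    have hdc : Continuous d :=
      Continuous.subtype_mk ((continuous_const.mul continuous_subtype_val).mul continuous_const) _
    have heq : (Kγ.comap (c j) : Set ↥(unipotentU σ J)) =
        d '' ((Subtype.val : ↥(unipotentU σ J) → ↥(unitaryGroupOfForm σ J)) ⁻¹' (Kγ : Set ↥(unitaryGroupOfForm σ J))) := by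
      ext n
      simp only [SetLike.mem_coe, Subgroup.mem_comap, mem_image, mem_preimage]
      constructor
      · intro hn
        refine ⟨⟨c j n, hnorm (haT j) n n.2⟩, hn, ?_⟩
        apply Subtype.ext
        show (a j)⁻¹ * (a j * n * (a j)⁻¹) * a j = n
        group
      · rintro ⟨m, hm, rfl⟩
        have : c j (d m) = (m : ↥(unitaryGroupOfForm σ J)) := by
          rw [hc_apply]
          show a j * ((a j)⁻¹ * (m : ↥(unitaryGroupOfForm σ J)) * a j) * (a j)⁻¹ = m
          group
        rw [this]
        exact hm
    rw [heq]
    exact hC.image hdc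
  · exact fun j => hKo.preimage (hc_cont j) -- open: preimage of the open `K_γ ∩ U` under the continuous conjugation
  · intro n -- exhaustion: `|ϖ|^j · sup |(n - 1)_{ik}| ≤ γ` for `j` large (archimedean value group)
    obtain ⟨j, hj⟩ := exists_pow_mul_le hγ0 hϖ1
      (Finset.univ.sup fun p : Fin 2 × Fin 2 =>
        valuation K (((((n : ↥(unitaryGroupOfForm σ J)) : GL (Fin 2) K) : Matrix (Fin 2) (Fin 2) K) - 1) p.1 p.2)) hγ0
    refine ⟨j, ?_⟩
    rw [Subgroup.mem_comap, Subgroup.mem_comap]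
    show ((c j n : ↥(unitaryGroupOfForm σ J)) : GL (Fin 2) K) ∈ congruenceGL 2 (valuation K ϖ)
    rw [hc_apply]
    refine hkey j n n.2 _ (fun i k => ?_) hj
    exact Finset.le_sup (f := fun p : Fin 2 × Fin 2 =>
      valuation K (((((n : ↥(unitaryGroupOfForm σ J)) : GL (Fin 2) K) : Matrix (Fin 2) (Fin 2) K) - 1) p.1 p.2)) (Finset.mem_univ (i, k))

end Model

/-! ## §2 The CM instance at a non-split place: the exhaustion of `N_v = (cmBorelTriple L 2 v).N` -/

section CM

open NumberField IsDedekindDomain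

variable (L : Type) [Field L] [NumberField L] [IsCMField L]

/-- At a non-split `v` (one place `w` above it) the one-place model ★ `localNonsplitEquiv` sends the unipotent radical `N_v` of the Borel of `U(Φ₂)(L⁺_v)` INTO the
upper unitriangular subgroup of `U(σ_w, Φ₂)(L_w)` (entries read at `w`; converse of ★ `localNonsplitEquiv_symm_mem_cmBorelTriple_N_two`).
[cite: PlatonovRapinchuk1994, §5.1] [cite: Rogawski1990, §1.10 p. 9] -/
theorem localNonsplitEquiv_mem_unipotentU_of_mem_cmBorelTriple_N_two (v : HeightOneSpectrum (𝓞 ↥(maximalRealSubfield L)))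
    (w : PlacesOver L v) (hw : IsCMField.complexConj L • w.1 = w.1)
    {g : «local» L (IsCMField.complexConj L) 2 (Matrix.of fun i j : Fin 2 => if i.val + j.val + 1 = 2 then (1 : L) else 0) v}
    (hg : g ∈ (cmBorelTriple L 2 v).N) :
    localNonsplitEquiv (IsCMField.complexConj L) (Matrix.of fun i j : Fin 2 => if i.val + j.val + 1 = 2 then (1 : L) else 0)
        (IsCMField.complexConj_ne_one L) w hw g ∈
      unipotentU (galAdicCompletionMap (L := L) (IsCMField.complexConj L) hw)
        (placeForm (Matrix.of fun i j : Fin 2 => if i.val + j.val + 1 = 2 then (1 : L) else 0) w.1) := by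
  have key : ∀ i j,
      (((localNonsplitEquiv (IsCMField.complexConj L) (Matrix.of fun i j : Fin 2 => if i.val + j.val + 1 = 2 then (1 : L) else 0)
            (IsCMField.complexConj_ne_one L) w hw g :
          ↥(unitaryGroupOfForm (galAdicCompletionMap (L := L) (IsCMField.complexConj L) hw)
            (placeForm (Matrix.of fun i j : Fin 2 => if i.val + j.val + 1 = 2 then (1 : L) else 0) w.1))) :
          GL (Fin 2) (w.1.adicCompletion L)) : Matrix (Fin 2) (Fin 2) (w.1.adicCompletion L)) i j =
        ((((g : «local» L (IsCMField.complexConj L) 2 (Matrix.of fun i j : Fin 2 => if i.val + j.val + 1 = 2 then (1 : L) else 0) v) :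
          GL (Fin 2) (LocalRing L v)) : Matrix (Fin 2) (Fin 2) (LocalRing L v)) i j) w := by
    intro i j
    have h := congr_fun (congr_fun (coe_localNonsplitEquiv_apply L (Matrix.of fun i j : Fin 2 => if i.val + j.val + 1 = 2 then (1 : L) else 0)
      v w hw g) i) j
    rw [Matrix.map_apply, Pi.evalRingHom_apply] at h
    exact h
  have hg' : ((g : «local» L (IsCMField.complexConj L) 2 (Matrix.of fun i j : Fin 2 => if i.val + j.val + 1 = 2 then (1 : L) else 0) v) :
      GL (Fin 2) (LocalRing L v)) ∈ upperUnitriangular (Fin 2) (LocalRing L v) := hg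
  obtain ⟨htri, hdiag⟩ := (mem_upperUnitriangular_iff _).1 hg'
  rw [mem_unipotentU_iff]
  refine ⟨fun i j hij => ?_, fun i => ?_⟩
  · rw [key, htri hij]
    rfl
  · rw [key, hdiag i]
    rfl

set_option maxHeartbeats 400000 in
/-- **THE EXHAUSTION OF `N_v` (item (i)).**  For a CM field `L` and a finite place `v` of `L⁺` NON-SPLIT in `L`, the unipotent radical `N_v = (cmBorelTriple L 2 v).N`
of the Borel of `U(Φ₂)(L⁺_v)` is an increasing union of compact open subgroups: transport of `exists_compactOpen_subgroups_exhausting_unipotentU_two` along the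
one-place model ★ `localNonsplitEquiv` (which matches the radicals in both directions; `ϖ := y σ_w(y)` for a uniformiser `y` of `L_w`).
[cite: Casselman1995, Prop. 1.4.4] [cite: Rogawski1990, §1.10 p. 9] [cite: PlatonovRapinchuk1994, §5.1] -/
theorem cm_exists_compactOpen_subgroups_exhausting_cmBorelN_two (v : HeightOneSpectrum (𝓞 ↥(maximalRealSubfield L)))
    (hns : ∀ w : PlacesOver L v, IsCMField.complexConj L • w.1 = w.1) :
    ∃ Nj : ℕ → Subgroup ↥(cmBorelTriple L 2 v).N, Monotone Nj ∧ (∀ j, IsCompact (Nj j : Set ↥(cmBorelTriple L 2 v).N)) ∧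
      (∀ j, IsOpen (Nj j : Set ↥(cmBorelTriple L 2 v).N)) ∧ ∀ n : ↥(cmBorelTriple L 2 v).N, ∃ j, n ∈ Nj j := by
  classical
  obtain ⟨w⟩ := (inferInstance : Nonempty (PlacesOver L v))
  have hw := hns w
  haveI : CharZero (w.1.adicCompletion L) := charZero_of_injective_algebraMap (algebraMap L (w.1.adicCompletion L)).injective
  -- the model and its data (as in ★ `cm_coinvariants_subsingleton_of_isSupercuspidal_two`)
  obtain ⟨e, he⟩ : ∃ e : ↥(unitaryGroupOfForm (conjLocal L (IsCMField.complexConj L) v) (cmLocalForm L 2 v)) ≃ₜ*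
      ↥(unitaryGroupOfForm (galAdicCompletionMap (L := L) (IsCMField.complexConj L) hw)
        (placeForm (Matrix.of fun i j : Fin 2 => if i.val + j.val + 1 = 2 then (1 : L) else 0) w.1)),
      e = localNonsplitEquiv (IsCMField.complexConj L) (Matrix.of fun i j : Fin 2 => if i.val + j.val + 1 = 2 then (1 : L) else 0)
        (IsCMField.complexConj_ne_one L) w hw := ⟨_, rfl⟩
  have hJw : placeForm (Matrix.of fun i j : Fin 2 => if i.val + j.val + 1 = 2 then (1 : L) else 0) w.1 =
      (StdForm.antidiagonal 2).over (w.1.adicCompletion L) := by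
    rw [placeForm, antidiagOne_eq_over, StdForm.over_map]
  have hσσ : ∀ x, galAdicCompletionMap (L := L) (IsCMField.complexConj L) hw (galAdicCompletionMap (L := L) (IsCMField.complexConj L) hw x) = x :=
    galAdicCompletionMap_galAdicCompletionMap_of_smul_eq (IsCMField.complexConj L) w (IsCMField.complexConj_ne_one L) hw
  obtain ⟨y, hy⟩ := exists_isUniformizingElement (F := w.1.adicCompletion L)
  have hσv : valuation (w.1.adicCompletion L) (galAdicCompletionMap (L := L) (IsCMField.complexConj L) hw y) = valuation (w.1.adicCompletion L) y := by
    have h := valued_galAdicCompletionMap (L := L) (IsCMField.complexConj L) hw y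
    rw [le_antisymm_iff, ← Valuation.vle_iff_le (Valued.v : Valuation (w.1.adicCompletion L) _),
      ← Valuation.vle_iff_le (Valued.v : Valuation (w.1.adicCompletion L) _)] at h
    rw [le_antisymm_iff, ← Valuation.vle_iff_le (valuation (w.1.adicCompletion L)), ← Valuation.vle_iff_le (valuation (w.1.adicCompletion L))]
    exact h
  have hϖ0 : y * galAdicCompletionMap (L := L) (IsCMField.complexConj L) hw y ≠ 0 :=
    mul_ne_zero hy.ne_zero ((map_ne_zero_iff _ (galAdicCompletionMap (L := L) (IsCMField.complexConj L) hw).injective).2 hy.ne_zero)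
  have hϖ1 : valuation (w.1.adicCompletion L) (y * galAdicCompletionMap (L := L) (IsCMField.complexConj L) hw y) < 1 := by
    rw [map_mul, hσv]
    exact mul_lt_one_of_nonneg_of_lt_one_left zero_le hy.valuation_lt_one hy.valuation_lt_one.le
  have hσϖ : galAdicCompletionMap (L := L) (IsCMField.complexConj L) hw (y * galAdicCompletionMap (L := L) (IsCMField.complexConj L) hw y) =
      y * galAdicCompletionMap (L := L) (IsCMField.complexConj L) hw y := by
    rw [map_mul, hσσ, mul_comm]
  -- the exhaustion in the model
  obtain ⟨Nj, hmono, hc, ho, hex⟩ := exists_compactOpen_subgroups_exhausting_unipotentU_two (galAdicCompletionMap (L := L) (IsCMField.complexConj L) hw) hJw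
    (continuous_galAdicCompletionMap (L := L) (IsCMField.complexConj L) hw) hϖ0 hϖ1 hσϖ
  -- the restricted maps `φ : N_v → N(model)`, `ψ : N(model) → N_v`, mutually inverse and continuous
  have hφmem : ∀ n : ↥(cmBorelTriple L 2 v).N, e n.1 ∈ unipotentU (galAdicCompletionMap (L := L) (IsCMField.complexConj L) hw)
      (placeForm (Matrix.of fun i j : Fin 2 => if i.val + j.val + 1 = 2 then (1 : L) else 0) w.1) := fun n => by
    rw [he]
    exact localNonsplitEquiv_mem_unipotentU_of_mem_cmBorelTriple_N_two L v w hw n.2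
  have hψmem : ∀ m : ↥(unipotentU (galAdicCompletionMap (L := L) (IsCMField.complexConj L) hw)
      (placeForm (Matrix.of fun i j : Fin 2 => if i.val + j.val + 1 = 2 then (1 : L) else 0) w.1)), e.symm m.1 ∈ (cmBorelTriple L 2 v).N :=
    fun m => by
    rw [he]
    exact localNonsplitEquiv_symm_mem_cmBorelTriple_N_two L v w hw m.2
  obtain ⟨φ, hφdef⟩ : ∃ φ : ↥(cmBorelTriple L 2 v).N →* ↥(unipotentU (galAdicCompletionMap (L := L) (IsCMField.complexConj L) hw)
      (placeForm (Matrix.of fun i j : Fin 2 => if i.val + j.val + 1 = 2 then (1 : L) else 0) w.1)),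
      φ = ((e : ↥(unitaryGroupOfForm (conjLocal L (IsCMField.complexConj L) v) (cmLocalForm L 2 v)) →*
        ↥(unitaryGroupOfForm (galAdicCompletionMap (L := L) (IsCMField.complexConj L) hw) (placeForm (Matrix.of fun i j : Fin 2 => if i.val + j.val + 1 = 2 then (1 : L) else 0) w.1))).comp
        (cmBorelTriple L 2 v).N.subtype).codRestrict _ (fun n => hφmem n) := ⟨_, rfl⟩
  have hφapp : ∀ n : ↥(cmBorelTriple L 2 v).N, (φ n).1 = e n.1 := fun n => by rw [hφdef]; rfl
  have hφc : Continuous φ := by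
    refine continuous_induced_rng.2 ?_
    have hcomp : (Subtype.val ∘ φ) = fun n : ↥(cmBorelTriple L 2 v).N => e n.1 := funext fun n => hφapp n
    rw [hcomp]
    exact e.continuous.comp continuous_subtype_val
  obtain ⟨ψ, hψdef⟩ : ∃ ψ : ↥(unipotentU (galAdicCompletionMap (L := L) (IsCMField.complexConj L) hw)
      (placeForm (Matrix.of fun i j : Fin 2 => if i.val + j.val + 1 = 2 then (1 : L) else 0) w.1)) → ↥(cmBorelTriple L 2 v).N,
      ψ = fun m => ⟨e.symm m.1, hψmem m⟩ := ⟨_, rfl⟩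
  have hψapp : ∀ m, (ψ m).1 = e.symm m.1 := fun m => by rw [hψdef]
  have hψc : Continuous ψ := by
    refine continuous_induced_rng.2 ?_
    have hcomp : (Subtype.val ∘ ψ) = fun m => e.symm m.1 := funext fun m => hψapp m
    rw [hcomp]
    exact e.symm.continuous.comp continuous_subtype_val
  have hφψ : ∀ m, φ (ψ m) = m := fun m => Subtype.ext (by rw [hφapp, hψapp]; exact e.apply_symm_apply _)
  have hψφ : ∀ n, ψ (φ n) = n := fun n => Subtype.ext (by rw [hψapp, hφapp]; exact e.symm_apply_apply _)
  refine ⟨fun j => (Nj j).comap φ, fun i j hij => Subgroup.comap_mono (hmono hij), fun j => ?_, fun j => (ho j).preimage hφc, fun n => ?_⟩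
  · -- compact: `φ⁻¹(N_j) = ψ(N_j)`
    have heq : ((Nj j).comap φ : Set ↥(cmBorelTriple L 2 v).N) = ψ '' (Nj j : Set _) := by
      ext n
      simp only [SetLike.mem_coe, Subgroup.mem_comap, mem_image]
      constructor
      · intro hn
        exact ⟨φ n, hn, hψφ n⟩
      · rintro ⟨m, hm, rfl⟩
        rw [hφψ]
        exact hm
    rw [heq]
    exact (hc j).image hψc
  · obtain ⟨j, hj⟩ := hex (φ n)
    exact ⟨j, Subgroup.mem_comap.2 hj⟩

end CM

/-! ## §3 (iii) The UNCONDITIONAL corollary: `N_v`-cuspidality of supercuspidal coefficients and of the normalised idempotent at a non-split place -/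

section Unconditional

open NumberField IsDedekindDomain
open Summit.HodgeConjecture.HodgeConjecture.Cruxes.H413.K2E1SupercuspidalCoefficientNCuspidal

variable (L : Type) [Field L] [NumberField L] [IsCMField L] (v : HeightOneSpectrum (𝓞 ↥(maximalRealSubfield L)))

/-- **(iii) THE NORMALISED SUPERCUSPIDAL IDEMPOTENT OF `U(Φ₂)(L⁺_v)` IS `N_v`-CUSPIDAL — UNCONDITIONALLY in Jacquet vanishing and exhaustion.**  `L` CM, `v` a finite
place of `L⁺` NON-SPLIT in `L`, `G_v = U(Φ₂)(L⁺_v) = ↥(unitaryGroupOfForm (conjLocal L c v) (cmLocalForm L 2 v))` with COMPACT CENTRE (`hZ`), `N_v = (cmBorelTriple L 2 v).N`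
with a right-invariant measure `μ` finite on compacta, `ρ₀` smooth SUPERCUSPIDAL with a `G_v`-invariant Hermitian form `B`, and `e g = c · B (ρ₀ g u) u` (K2E1-p06 (g2)'s
★ p855188 idempotent): `∀ x y, ∫_{N_v} e(x n y) dμ(n) = 0` — ★ p855253 `UnitaryGroup.integral_idempotent_translate_cmBorelN_eq_zero` with `hJ` discharged by ★
`cm_forall_mem_span_sub_of_isSupercuspidal_two` and `Nj` by `cm_exists_compactOpen_subgroups_exhausting_cmBorelN_two`.  This is the local input of rung 2 (ii) of
socket 5R (★ p855202 `K2E1PoincareSeriesConstantTerm`). [cite: HarishChandra1970, Part I §3 p. 9] [cite: Casselman1995, Thm. 5.3.1] [cite: Rogawski1990, §13.8 p. 218 (i)–(iii)] -/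
theorem _root_.Literature.NumberTheory.Automorphic.UnitaryGroup.integral_idempotent_translate_cmBorelN_two_eq_zero
    (hns : ∀ w : PlacesOver L v, IsCMField.complexConj L • w.1 = w.1)
    [MeasurableSpace ↥(cmBorelTriple L 2 v).N] [BorelSpace ↥(cmBorelTriple L 2 v).N]
    (μ : Measure ↥(cmBorelTriple L 2 v).N) [IsFiniteMeasureOnCompacts μ] [μ.IsMulRightInvariant]
    {V : Type*} [AddCommGroup V] [Module ℂ V]
    (ρ₀ : Representation ℂ ↥(unitaryGroupOfForm (conjLocal L (IsCMField.complexConj L) v) (cmLocalForm L 2 v)) V)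
    {B : V →ₗ⋆[ℂ] V →ₗ[ℂ] ℂ} (hsc : ρ₀.IsSupercuspidal)
    (hZ : IsCompact (Subgroup.center ↥(unitaryGroupOfForm (conjLocal L (IsCMField.complexConj L) v) (cmLocalForm L 2 v)) :
      Set ↥(unitaryGroupOfForm (conjLocal L (IsCMField.complexConj L) v) (cmLocalForm L 2 v))))
    (hsm : ρ₀.IsSmooth) (hBsymm : B.IsSymm) (hBinv : ∀ g (x w : V), B (ρ₀ g x) (ρ₀ g w) = B x w)
    {u : V} {c : ℂ} {e : ↥(unitaryGroupOfForm (conjLocal L (IsCMField.complexConj L) v) (cmLocalForm L 2 v)) → ℂ} (he : ∀ g, e g = c * B (ρ₀ g u) u)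
    (x y : ↥(unitaryGroupOfForm (conjLocal L (IsCMField.complexConj L) v) (cmLocalForm L 2 v))) :
    ∫ n : ↥(cmBorelTriple L 2 v).N, e (x * n * y) ∂μ = 0 := by
  obtain ⟨Nj, hmono, hc, ho, hex⟩ := cm_exists_compactOpen_subgroups_exhausting_cmBorelN_two L v hns
  exact UnitaryGroup.integral_idempotent_translate_cmBorelN_eq_zero L 2 v μ ρ₀ hsc hZ hsm hBsymm hBinv
    (cm_forall_mem_span_sub_of_isSupercuspidal_two L v hns ρ₀ hsm hsc) Nj hmono hc ho hex he x y

/-- **(iii′) EVERY MATRIX COEFFICIENT OF A SUPERCUSPIDAL `ρ₀` OF `U(Φ₂)(L⁺_v)` IS `N_v`-CUSPIDAL** (non-split `v`, compact centre): `∀ x y u u′,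
∫_{N_v} B (ρ₀(x n y) u) u′ dμ(n) = 0` (★ p855253 `integral_sesqForm_translate_apply_eq_zero_of_isSupercuspidal` with `hJ`, `Nj` discharged) — Harish-Chandra's
«matrix coefficients of supercuspidal representations are supercusp forms», cusp condition (ii), for `U(1,1)` over `L⁺_v`. [cite: HarishChandra1970, Part I §3 p. 9]
[cite: Casselman1995, Thm. 5.3.1] -/
theorem _root_.Literature.NumberTheory.Automorphic.UnitaryGroup.integral_sesqForm_translate_apply_cmBorelN_two_eq_zero
    (hns : ∀ w : PlacesOver L v, IsCMField.complexConj L • w.1 = w.1)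
    [MeasurableSpace ↥(cmBorelTriple L 2 v).N] [BorelSpace ↥(cmBorelTriple L 2 v).N]
    (μ : Measure ↥(cmBorelTriple L 2 v).N) [IsFiniteMeasureOnCompacts μ] [μ.IsMulRightInvariant]
    {V : Type*} [AddCommGroup V] [Module ℂ V]
    (ρ₀ : Representation ℂ ↥(unitaryGroupOfForm (conjLocal L (IsCMField.complexConj L) v) (cmLocalForm L 2 v)) V)
    {B : V →ₗ⋆[ℂ] V →ₗ[ℂ] ℂ} (hsc : ρ₀.IsSupercuspidal)
    (hZ : IsCompact (Subgroup.center ↥(unitaryGroupOfForm (conjLocal L (IsCMField.complexConj L) v) (cmLocalForm L 2 v)) :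
      Set ↥(unitaryGroupOfForm (conjLocal L (IsCMField.complexConj L) v) (cmLocalForm L 2 v))))
    (hsm : ρ₀.IsSmooth) (hBsymm : B.IsSymm) (hBinv : ∀ g (x w : V), B (ρ₀ g x) (ρ₀ g w) = B x w)
    (x y : ↥(unitaryGroupOfForm (conjLocal L (IsCMField.complexConj L) v) (cmLocalForm L 2 v))) (u u' : V) :
    ∫ n : ↥(cmBorelTriple L 2 v).N, B (ρ₀ (x * n * y) u) u' ∂μ = 0 := by
  haveI : T2Space ↥(unitaryGroupOfForm (conjLocal L (IsCMField.complexConj L) v) (cmLocalForm L 2 v)) := inferInstance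
  obtain ⟨Nj, hmono, hc, ho, hex⟩ := cm_exists_compactOpen_subgroups_exhausting_cmBorelN_two L v hns
  exact integral_sesqForm_translate_apply_eq_zero_of_isSupercuspidal ρ₀ (cmBorelTriple L 2 v).N μ hsc hZ hsm hBsymm hBinv
    (isClosed_coe_cmBorelTriple_N L 2 v) (cm_forall_mem_span_sub_of_isSupercuspidal_two L v hns ρ₀ hsm hsc) Nj hmono hc ho hex x y u u'

end Unconditional

end Summit.HodgeConjecture.HodgeConjecture.Cruxes.H413.K2E1UnipotentExhaustionU2

end
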